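import Summits.ABC.IUTFork.Joshi.TestHonestPinsLinkPin
import HarnessLib

/-!
# Branch E TEST — WHAT THE THIRD PIN ADDS TO THE GAPS: `GapA3` / `GapH3` vs the two-pin `GapA''` (E-ROW R-65 lineage, interface level)

Proof-only calibration (abc-iut cell, D-0079 R-J «Joshi Y-discharge census», E-ROW R-65 / R-70 lineage; seat abc-iut-E-t42, gen 9; 0 definitions,
0 instances, no `Prop` fact, FACT rows used: none; everything BY NAME).  The adjudication's three-pin vocabulary (abc-iut-w5-d230 / director-abc
2026-08-26T02:18:52Z, `Cor312PinnedRegionsThreePins`: `PinnedRegions3 := PinnedRegions ∧ LinkPinned`, `GapA3`, `GapH3`; ADJUDICATION-SPEC v2.3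
(G-PINNED-2) (a) «a model that omits the link is graded interface-level») is read through ★ p524016 §1 (`GenuinePinsLinkPin.pilotLink_iff_nonempty_equiv`:
the typed link pin (pL) is `Nonempty (Ob 𝒞⊩_lgp ≃ Ob 𝒞⊩_△)`, a condition on the two context object TYPES alone).  Consequences, for EVERY lattice
situation `S`, setting `P`, region operator `ρ` and q-datum `qK`:

* **`gapA3_iff_nonempty_equiv_imp_gapA''`** — `GapA3 S P ρ qK ↔ (Nonempty (P.Ob P.sig.Clgp ≃ P.ObΔ) → GapA'' S P ρ qK)`: the three-pin
  identification-level gap IS the two-pin gap abc-iut-w5-d230 filed first (`Cor312PinnedRegions.GapA''`), guarded by equinumerosity of the object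
  types; `gapA3_iff_gapA''_of_equiv` (any bijection ⇒ the two gaps coincide), `gapA3_of_isEmpty_equiv` (no bijection ⇒ `GapA3` vacuously).
* **`gapH3_iff_nonempty_equiv_imp`** — the hull-level twin: `GapH3 S P ρ qK ↔ (Nonempty (…) → (PinnedRegions S P ρ qK → Licence P))`;
  `gapH3_of_isEmpty_equiv`.
* **«omits the link» located**: `not_linkPinned_iff_isEmpty_equiv` — a setting omits (pL) iff its two object types are NOT equinumerous; so every
  model of record with one-point `𝒞⊩_lgp`, `𝒞⊩_△` (the c312-7 / c312-13 / w5-d230 pinned countermodels, the honest carrier ★ p524924) carries the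
  link, and (G-PINNED-2) (a) excludes exactly the cardinality-mismatched context data of ★ p524016 §2 — nothing that reads pilots, regions or volumes.
* At the honest carrier (★ p524924 `HonestPinsLinkPin.linkPinned_honestSetting`): **`gapA3_honestSetting_iff_gapA''`**, `gapH3_honestSetting_iff`.

READING (tree currency; located, not adjudicated; COUNT-NEUTRAL).  This does not weaken or strengthen any gap of record: it says the third pin, AS
TYPED at the object level (abc-iut-c312-1 `Thm311ToCor312.PilotLink`, Step (xii) «only preserves isomorphism classes of objects»), contributes to
`GapA3`/`GapH3` only the guard `#Ob(𝒞⊩_lgp) = #Ob(𝒞⊩_△)`; whatever content print's Θ×μ_LGP-link carries toward (xi-e)/(xi-f) is not in (pL) but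
would have to enter through the glue maps / `ρ` (E-LOCATION's located sentence S).  **No side is taken** on [IUTchIII] Cor. 3.12 / [IUTchIV] Thm. 1.10
or on any author (Mochizuki / Scholze–Stix / Joshi / Dupuy–Hilado); typed ≠ proved; NOT an abc claim. [claim: Mochizuki2012, status: disputed]
-/

noncomputable section

open Set Function

namespace Summit.ABC.IUTFork.Joshi

namespace LinkPinThreePinGaps

open Thm311 Thm311.Real Cor312 Cor312Vol Literature.IUT.LogThetaLattice Literature.IUT.LogVolume GenuinePinsLinkPin HonestPinsLinkPin

/-! ## 1. Interface level -/

section Interface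

variable {T : ThetaIndex} (S : LatticeSituation T) (P : Cor312.Setting S.toSituation)
  (ρ : (∀ v : T.V, v ∈ T.Vbad → Set (S.L.StarPacket v)) → ∀ (j : T.Label) (vQ : T.VQ), Set (S.L.Packet j vQ))
  (qK : ∀ v : T.V, v ∈ T.Vbad → Set (S.L.StarPacket v))

/-- **«Omits the link» located**: a setting fails (pL) iff its two context object types are not equinumerous. [claim: Mochizuki2012, status: disputed] -/
theorem not_linkPinned_iff_isEmpty_equiv : ¬ LinkPinned S P ↔ IsEmpty (P.Ob P.sig.Clgp ≃ P.ObΔ) := by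
  rw [linkPinned_iff_nonempty_equiv, not_nonempty_iff]

/-- Given any bijection of the object types, THREE PINS ⟺ TWO PINS. [claim: Mochizuki2012, status: disputed] -/
theorem pinnedRegions3_iff_pinnedRegions_of_equiv (e : P.Ob P.sig.Clgp ≃ P.ObΔ) : PinnedRegions3 S P ρ qK ↔ PinnedRegions S P ρ qK :=
  and_iff_left (pilotLink_of_equiv P e)

/-- **`GapA3 ↔ (Nonempty (Ob 𝒞⊩_lgp ≃ Ob 𝒞⊩_△) → GapA'')`** — the three-pin identification-level gap is the two-pin gap guarded by
equinumerosity of the object types. [claim: Mochizuki2012, status: disputed] -/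
theorem gapA3_iff_nonempty_equiv_imp_gapA'' : GapA3 S P ρ qK ↔ (Nonempty (P.Ob P.sig.Clgp ≃ P.ObΔ) → GapA'' S P ρ qK) :=
  ⟨fun h ⟨e⟩ hpin => h ⟨hpin, pilotLink_of_equiv P e⟩, fun h hpin => h ((pilotLink_iff_nonempty_equiv P).1 hpin.2) hpin.1⟩

/-- With a bijection in hand the two gaps COINCIDE. [claim: Mochizuki2012, status: disputed] -/
theorem gapA3_iff_gapA''_of_equiv (e : P.Ob P.sig.Clgp ≃ P.ObΔ) : GapA3 S P ρ qK ↔ GapA'' S P ρ qK :=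
  (gapA3_iff_nonempty_equiv_imp_gapA'' S P ρ qK).trans ⟨fun h => h ⟨e⟩, fun h _ => h⟩

/-- Without a bijection `GapA3` holds VACUOUSLY (abc-iut-w5-d230's `gapA3_of_not_linkPinned`, located). [folklore] -/
theorem gapA3_of_isEmpty_equiv (h : IsEmpty (P.Ob P.sig.Clgp ≃ P.ObΔ)) : GapA3 S P ρ qK :=
  gapA3_of_not_linkPinned S P ρ qK ((not_linkPinned_iff_isEmpty_equiv S P).2 h)

/-- **Hull-level twin: `GapH3 ↔ (Nonempty (Ob 𝒞⊩_lgp ≃ Ob 𝒞⊩_△) → (PinnedRegions → Licence))`.** [claim: Mochizuki2012, status: disputed] -/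
theorem gapH3_iff_nonempty_equiv_imp :
    GapH3 S P ρ qK ↔ (Nonempty (P.Ob P.sig.Clgp ≃ P.ObΔ) → (PinnedRegions S P ρ qK → Thm311ToCor312.Licence P)) :=
  ⟨fun h ⟨e⟩ hpin => h ⟨hpin, pilotLink_of_equiv P e⟩, fun h hpin => h ((pilotLink_iff_nonempty_equiv P).1 hpin.2) hpin.1⟩

/-- With a bijection in hand `GapH3` is «TWO PINS ⟹ Licence». [claim: Mochizuki2012, status: disputed] -/
theorem gapH3_iff_of_equiv (e : P.Ob P.sig.Clgp ≃ P.ObΔ) : GapH3 S P ρ qK ↔ (PinnedRegions S P ρ qK → Thm311ToCor312.Licence P) :=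
  (gapH3_iff_nonempty_equiv_imp S P ρ qK).trans ⟨fun h => h ⟨e⟩, fun h _ => h⟩

/-- Without a bijection `GapH3` holds VACUOUSLY. [folklore] -/
theorem gapH3_of_isEmpty_equiv (h : IsEmpty (P.Ob P.sig.Clgp ≃ P.ObΔ)) : GapH3 S P ρ qK :=
  gapH3_of_not_pinned3 S P ρ qK fun hpin => h.false ((pilotLink_iff_nonempty_equiv P).1 hpin.2).some

/-- One-point context data (both object types subsingleton and inhabited — every pinned countermodel of record): THREE PINS ⟺ TWO PINS and the
gaps coincide. [claim: Mochizuki2012, status: disputed] -/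
theorem gapA3_iff_gapA''_of_unique [Unique (P.Ob P.sig.Clgp)] [Unique P.ObΔ] : GapA3 S P ρ qK ↔ GapA'' S P ρ qK :=
  gapA3_iff_gapA''_of_equiv S P ρ qK (Equiv.ofUnique _ _)

end Interface

/-! ## 2. At the honest carrier the link guard is discharged -/

section Honest

variable {F : Type} [Field F] [NumberField F] (X : PilotData F) {logv : PadicLogs F} (hlog : LogvAnalytic logv)
  (Aut Ism : ∀ x : Thm311.Real.Place F, Set (Carrier x ≃ₗ[ℚ] Carrier x))
  (hAut : ∀ x, LinearEquiv.refl ℚ (Carrier x) ∈ Aut x) (hIsm : ∀ x, LinearEquiv.refl ℚ (Carrier x) ∈ Ism x)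
  (M : Type) [Field M] [NumberField M]
  (archPk : ∀ (j : (thetaIndex X).Label) (vQ : (thetaIndex X).VQ), Set ((logShells X logv Aut Ism hAut hIsm).Packet j vQ))
  (archSub : ∀ (j : (thetaIndex X).Label) (v : (thetaIndex X).V),
    Set ((logShells X logv Aut Ism hAut hIsm).Packet j ((thetaIndex X).over v)))
  (Ψ : ℤ → ∀ v : (thetaIndex X).V, v ∈ (thetaIndex X).Vbad → Set ((logShells X logv Aut Ism hAut hIsm).StarPacket v))
  (act : ℤ → ∀ v : (thetaIndex X).V, v ∈ (thetaIndex X).Vbad →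
    (logShells X logv Aut Ism hAut hIsm).StarPacket v → Module.End ℚ ((logShells X logv Aut Ism hAut hIsm).StarPacket v))
  (Mmod : ℤ → ∀ j : (thetaIndex X).LabelStar, Set ((logShells X logv Aut Ism hAut hIsm).GlobalPacket j.1))
  (region : ℤ → ∀ j : (thetaIndex X).LabelStar, FinDivisor M → ∀ vQ : (thetaIndex X).VQ,
    Set ((logShells X logv Aut Ism hAut hIsm).Packet j.1 vQ))
  (col : ℤ → Column (logShells X logv Aut Ism hAut hIsm)) (n : ℤ) (p : ℕ) [hp : Fact p.Prime]
  (ρ : (∀ v : (thetaIndex X).V, v ∈ (thetaIndex X).Vbad → Set ((logShells X logv Aut Ism hAut hIsm).StarPacket v)) →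
    ∀ (j : (thetaIndex X).Label) (vQ : (thetaIndex X).VQ), Set ((logShells X logv Aut Ism hAut hIsm).Packet j vQ))
  (qK : ∀ v : (thetaIndex X).V, v ∈ (thetaIndex X).Vbad → Set ((logShells X logv Aut Ism hAut hIsm).StarPacket v))

omit hp in
/-- **At the honest carrier `GapA3 ⟺ GapA''`** (the link guard is discharged by ★ p524924). [claim: Mochizuki2012, status: disputed] -/
theorem gapA3_honestSetting_iff_gapA'' :
    GapA3 (latticeSituationReal X hlog Aut Ism hAut hIsm M archPk archSub Ψ act Mmod region col)
        (honestSetting X hlog Aut Ism hAut hIsm M archPk archSub Ψ act Mmod region col n p) ρ qK ↔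
      GapA'' (latticeSituationReal X hlog Aut Ism hAut hIsm M archPk archSub Ψ act Mmod region col)
        (honestSetting X hlog Aut Ism hAut hIsm M archPk archSub Ψ act Mmod region col n p) ρ qK :=
  gapA3_iff_gapA''_of_equiv (latticeSituationReal X hlog Aut Ism hAut hIsm M archPk archSub Ψ act Mmod region col)
    (honestSetting X hlog Aut Ism hAut hIsm M archPk archSub Ψ act Mmod region col n p) ρ qK (Equiv.refl Unit)

omit hp in
/-- **At the honest carrier `GapH3 ⟺ (TWO PINS ⟹ Licence)`.** [claim: Mochizuki2012, status: disputed] -/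
theorem gapH3_honestSetting_iff :
    GapH3 (latticeSituationReal X hlog Aut Ism hAut hIsm M archPk archSub Ψ act Mmod region col)
        (honestSetting X hlog Aut Ism hAut hIsm M archPk archSub Ψ act Mmod region col n p) ρ qK ↔
      (PinnedRegions (latticeSituationReal X hlog Aut Ism hAut hIsm M archPk archSub Ψ act Mmod region col)
          (honestSetting X hlog Aut Ism hAut hIsm M archPk archSub Ψ act Mmod region col n p) ρ qK →
        Thm311ToCor312.Licence (honestSetting X hlog Aut Ism hAut hIsm M archPk archSub Ψ act Mmod region col n p)) :=
  gapH3_iff_of_equiv (latticeSituationReal X hlog Aut Ism hAut hIsm M archPk archSub Ψ act Mmod region col)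
    (honestSetting X hlog Aut Ism hAut hIsm M archPk archSub Ψ act Mmod region col n p) ρ qK (Equiv.refl Unit)

end Honest

end LinkPinThreePinGaps

end Summit.ABC.IUTFork.Joshi

end
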